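import Summits.QuantumFields.YangMills.Theses.CheckerboardTriality
import HarnessLib

/-!
# Route `CheckerboardTriality`: the Assembly item (stmt-QuantumFields-22568)

`TrialityLimit → SexticClosure → BalabanLadder.ROT` (rung R2d), pure logic over the tree:
`TrialityLimit` supplies, per admissible leg scheme, a radius `r₀ > 0` and the `W(F₄) = Aut(D₄)`-invariance of
every off-diagonal limit point on King's class `KingClass n r₀`; `SexticClosure` widens it to invariance under the
`(x₀,x₁)`-rotations by the Pythagorean angles on the same class; that is precisely the hypothesis of the tree's door
`Theorems.ROT.rot_of_kingLimit` (UV compactness from the PROVED `Theorems.ROT.stub_uvExtract` and the leaf's own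
`MomentBounds6`, then the King upgrade `latticeRotWard_of_uvCompactAt_of_latticeKingWard` at the dense subgroup
`King.dense_closure_pythagoreanAngles`), whose conclusion is the leaf `ROT`.

Width seat ym-line-sfw-p2-w2 g21 for planner-of-record ym-idea-1 g8 (LINE g8-A).  The two cruxes `TrialityLimit`
(stmt-QuantumFields-22566) and `SexticClosure` (stmt-QuantumFields-22567) remain OPEN; no summit, leg or rung statement
is proved here (R2d is a RECORD rung; the YM mass gap is NOT proved by any of this).
-/

set_option autoImplicit false

namespace Summit.QuantumFields.YangMills.Theorems

open Filter Topology
open Summit.QuantumFields.YangMills.Theses.CheckerboardTriality (TrialityLimit SexticClosure)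

/-- **Glue of route `CheckerboardTriality`**: `W(F₄)`-invariance of the off-diagonal limit points on King's class
(`TrialityLimit`) and its widening to the Pythagorean `(x₀,x₁)`-rotations (`SexticClosure`) give the rotation leg
`BalabanLadder.ROT`, through the tree's King door `Theorems.ROT.rot_of_kingLimit`. [folklore] -/
theorem checkerboardTriality_rot_of_trialityLimit_of_sexticClosure (h₁ : TrialityLimit) (h₂ : SexticClosure) :
    Summit.QuantumFields.YangMills.Theses.BalabanLadder.ROT := by
  refine Summit.QuantumFields.YangMills.Theorems.ROT.rot_of_kingLimit ?_
  intro G _ _ _ _ hG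
  letI : MeasurableSpace G := borel G
  haveI : BorelSpace G := ⟨rfl⟩
  intro r a ha ha0 hUV sch hsch
  obtain ⟨r₀, hr₀, H₁⟩ := h₁ G hG r a ha ha0 hUV sch hsch
  refine ⟨r₀, hr₀, fun φ hφ S₁ hS₁ => ?_⟩
  exact h₂ G hG r a ha ha0 hUV sch hsch r₀ hr₀ φ hφ S₁ hS₁ (fun n hn F hF R hR => H₁ φ hφ S₁ hS₁ n hn F hF R hR)

/-- **Item stmt-QuantumFields-22568 `CheckerboardTriality.Assembly` holds**: `TrialityLimit → SexticClosure → ROT`.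
[folklore] -/
theorem checkerboardTriality_assembly_proof :
    Summit.QuantumFields.YangMills.Theses.CheckerboardTriality.Assembly :=
  fun h₁ h₂ => checkerboardTriality_rot_of_trialityLimit_of_sexticClosure h₁ h₂

end Summit.QuantumFields.YangMills.Theorems
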